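import Summits.KontsevichZagierPeriods.KontsevichZagierPeriods.Theorems.HermiteRigidityRealEllipticSectorKernelStubExactForm
import Summits.KontsevichZagierPeriods.KontsevichZagierPeriods.Theorems.EllipticMomentKernel.Negative.Roots
import Summits.KontsevichZagierPeriods.KontsevichZagierPeriods.Theorems.IsogenyCertificatesXMapPeriodTransferStubCubicComponents

/-!
# `XMapKernel` (stmt-KontsevichZagierPeriods-10663, route IsogenyCertificates) — line
`derived-datum-quasi-periods`, stub `stub_hermiteMoveRat`

The Hermite move with a RATIONAL certificate. Let `P = X³ + AX + B` (`A, B ∈ ℤ`) have three real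
roots `e₃ < e₂ < e₁` (`4A³ + 27B² < 0`); its egg `E = {P > 0} ∖ (unbounded component)` is the open
interval `(e₃, e₂)`, with closure `[e₃, e₂]`. For `u, g ∈ ℚ[X]` with `g ≠ 0` on `[e₃, e₂]` put
`S = u/g` and `L(S) = P·S′ + ½P′·S = (2P(u′g − ug′) + P′ug)/(2g²)`, so that `L(S)/√P = (S√P)′` on
`(e₃, e₂)`. Then every representation `r = [E, L(S)/√P]` has `[r] ∈ KZ.relations`.

Derivation inside the calculus (no integral is evaluated), copied from the polynomial case
`HermiteRigidity.RealEllipticSectorKernel.stub_exactForm`: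
* ONE Newton–Leibniz move (`KZ.newtonLeibnizRel`, printed rule 3) with base `ℝ⁰`, constant bounds
  `e₃ ≤ e₂` (real algebraic, hence `ℚ`-semialgebraic constants), CLOSED band
  `[e₃, e₂] = r.domain ∪ {e₃, e₂} ⊆ ℝ¹` carrying `𝟙_{r.domain} · r.integrand`, and primitive
  `F = (u/g)·√P`: `ℚ`-semialgebraic on the band (quotient of polynomials with non-vanishing
  denominator, times a square root), continuous on `[e₃, e₂]` (`g ≠ 0` there), with derivative the
  integrand on `(e₃, e₂)` (`P > 0` there) and `F(e₂) − F(e₃) = 0 − 0 = 0`, the (zero) integrand of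
  the base;
* the base `[ℝ⁰, 0]` is a relation (zero integrand), so the band representation is a relation;
* ONE domain-additivity move (rule 1a): the two endpoints are Lebesgue-null, so `[r]` is a
  relation.
The identification `E = (e₃, e₂)` is the sibling `XMapPeriodTransferCells.stub_cubicComponents`
applied to the located roots of `EllipticMomentKernelNegative.exists_roots` (`q₂ = −4A`,
`q₃ = −4B`). [Kontsevich–Zagier 2001, §1.2, rules (1), (3)]
-/

noncomputable section

open Polynomial Set MeasureTheory

namespace Summit.KontsevichZagierPeriods.IsogenyCertificates.XMapKernelStubs.HermiteMoveRat

open Literature.NumberTheory.Transcendental Literature.ModelTheory.ExponentialFields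
open Summit.KontsevichZagierPeriods.HermiteRigidity

/-- The three-real-root picture of `P = X³ + AX + B` when `4A³ + 27B² < 0`: two roots `e₃ < e₂`
with `P > 0` on `(e₃, e₂)`, and `(e₃, e₂)` is the egg `{P > 0} ∖ (unbounded component)`.
[folklore] -/
theorem hermiteMoveRat_roots (A B : ℤ) (hΔ : 4 * A ^ 3 + 27 * B ^ 2 < 0) :
    ∃ e₃ e₂ : ℝ, e₃ < e₂ ∧ e₃ ^ 3 + (A : ℝ) * e₃ + (B : ℝ) = 0 ∧
      e₂ ^ 3 + (A : ℝ) * e₂ + (B : ℝ) = 0 ∧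
      (∀ x ∈ Ioo e₃ e₂, 0 < x ^ 3 + (A : ℝ) * x + (B : ℝ)) ∧
      Ioo e₃ e₂ = {y : ℝ | 0 < y ^ 3 + (A : ℝ) * y + (B : ℝ)} \
        connectedComponentIn {y : ℝ | 0 < y ^ 3 + (A : ℝ) * y + (B : ℝ)}
          (1 + |(A : ℝ)| + |(B : ℝ)|) := by
  have hcub : ∀ x : ℝ, EllipticMomentKernelNegative.cubic (-4 * (A : ℚ)) (-4 * (B : ℚ)) x =
      4 * (x ^ 3 + (A : ℝ) * x + (B : ℝ)) := by
    intro x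
    unfold EllipticMomentKernelNegative.cubic
    push_cast
    ring
  have hdisc : 0 < EllipticMomentKernelNegative.disc (-4 * (A : ℚ)) (-4 * (B : ℚ)) := by
    unfold EllipticMomentKernelNegative.disc
    have h : ((4 * A ^ 3 + 27 * B ^ 2 : ℤ) : ℝ) < 0 := by exact_mod_cast hΔ
    push_cast at h ⊢
    nlinarith
  obtain ⟨e₃, e₂, e₁, h3, h2a, h2b, h1, hf⟩ := EllipticMomentKernelNegative.exists_roots hdisc
  have h32 : e₃ < e₂ := h3.trans h2a
  have h21 : e₂ < e₁ := h2b.trans h1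
  have hroot : ∀ e : ℝ, EllipticMomentKernelNegative.cubic (-4 * (A : ℚ)) (-4 * (B : ℚ)) e = 0 →
      e ^ 3 + (A : ℝ) * e + (B : ℝ) = 0 := by
    intro e he
    rw [hcub] at he
    linarith
  have he₃ : e₃ ^ 3 + (A : ℝ) * e₃ + (B : ℝ) = 0 := hroot e₃ (by rw [hf]; ring)
  have he₂ : e₂ ^ 3 + (A : ℝ) * e₂ + (B : ℝ) = 0 := hroot e₂ (by rw [hf]; ring)
  have hpos : ∀ x ∈ Ioo e₃ e₂, 0 < x ^ 3 + (A : ℝ) * x + (B : ℝ) := fun x hx => by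
    have := (EllipticMomentKernelNegative.cubic_sign_of_roots h32 h21 hf).1 x hx
    rw [hcub] at this
    linarith
  exact ⟨e₃, e₂, h32, he₃, he₂, hpos,
    (XMapPeriodTransferCells.stub_cubicComponents A B hΔ.ne _ rfl e₃ he₃).2 e₂ he₂ h32 hpos⟩

/-- `P = X³ + AX + B ∈ ℚ[X]` evaluates at a real point to `t³ + At + B`. [folklore] -/
theorem hermiteMoveRat_aeval_cubic (A B : ℤ) (t : ℝ) :
    aeval t (X ^ 3 + C (A : ℚ) * X + C (B : ℚ) : ℚ[X]) = t ^ 3 + (A : ℝ) * t + (B : ℝ) := by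
  simp

/-- A quotient `z ↦ u(z i)/g(z i)` of one-variable rational polynomials evaluated at one coordinate
is a `ℚ`-semialgebraic function on every `ℚ`-semialgebraic `s ⊆ ℝⁿ` on which the denominator does
not vanish (it is the quotient of the `MvPolynomial`s `u(Xᵢ)`, `g(Xᵢ)`). [folklore] -/
theorem hermiteMoveRat_isSemialgebraicFunOn_div {n : ℕ} {s : Set (Fin n → ℝ)}
    (hs : IsSemialgebraic ℚ s) (u g : ℚ[X]) (i : Fin n) (hg : ∀ z ∈ s, aeval (z i) g ≠ 0) :
    IsSemialgebraicFunOn ℚ s (fun z => aeval (z i) u / aeval (z i) g) := by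
  have key : ∀ (p : ℚ[X]) (z : Fin n → ℝ),
      MvPolynomial.aeval z (aeval (MvPolynomial.X i : MvPolynomial (Fin n) ℚ) p) = aeval (z i) p :=
    fun p z => by rw [← Polynomial.aeval_algHom_apply, MvPolynomial.aeval_X]
  refine (isSemialgebraicFunOn_aeval_div_aeval hs
    (aeval (MvPolynomial.X i : MvPolynomial (Fin n) ℚ) u)
    (aeval (MvPolynomial.X i : MvPolynomial (Fin n) ℚ) g) fun z hz => ?_).congr fun z _ => ?_
  · rw [key]
    exact hg z hz
  · simp only [key]

/-- The derivative of the rational Hermite primitive `(u/g)√P` where `P > 0` and `g ≠ 0`: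
`((u/g)√P)′ = (2P(u′g − ug′) + P′ug)/(2g²√P)`, `P = t³ + At + B`. [folklore] -/
theorem hermiteMoveRat_hasDerivAt (A B : ℝ) (u g : ℚ[X]) {t : ℝ} (ht : 0 < t ^ 3 + A * t + B)
    (hg : aeval t g ≠ 0) :
    HasDerivAt (fun s : ℝ => aeval s u / aeval s g * Real.sqrt (s ^ 3 + A * s + B))
      ((2 * (t ^ 3 + A * t + B) *
          (aeval t (derivative u) * aeval t g - aeval t u * aeval t (derivative g)) +
        (3 * t ^ 2 + A) * aeval t u * aeval t g) /
        (2 * (aeval t g) ^ 2 * Real.sqrt (t ^ 3 + A * t + B))) t := by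
  have hP : HasDerivAt (fun s : ℝ => s ^ 3 + A * s + B) (3 * t ^ 2 + A) t := by
    simpa using ((hasDerivAt_pow 3 t).add ((hasDerivAt_id t).const_mul A)).add_const B
  have h1 := ((u.hasDerivAt_aeval t).fun_div (g.hasDerivAt_aeval t) hg).fun_mul (hP.sqrt ht.ne')
  refine h1.congr_deriv ?_
  obtain ⟨s, hs⟩ : ∃ s, s = Real.sqrt (t ^ 3 + A * t + B) := ⟨_, rfl⟩
  have hs0 : 0 < s := hs ▸ Real.sqrt_pos.mpr ht
  have hs2 : s * s = t ^ 3 + A * t + B := hs ▸ Real.mul_self_sqrt ht.le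
  rw [← hs, ← hs2]
  field_simp

/-- **Stub `stub_hermiteMoveRat`** (registered stub of crux stmt-KontsevichZagierPeriods-10663, line
`derived-datum-quasi-periods`). Hermite move with a rational certificate `S = u/g`, `g ≠ 0` on the
closed egg `[e₃, e₂]` of a three-real-root cubic `P = X³+AX+B`: the representation
`[egg, L(S)/√P]`, `L(S) = P·S′ + ½P′·S = (2P(u′g − ug′) + P′ug)/(2g²)`, is a relation — ONE
Newton–Leibniz move over the base point with band `[e₃, e₂]` and primitive `F = S·√P`
(`ℚ`-semialgebraic; continuous on `[e₃,e₂]`; `F(e₃) = F(e₂) = 0`; derivative `L(S)/√P` inside),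
then rule (1a) between the closed and the open egg.
[Kontsevich–Zagier 2001, §1.2, rules (1), (3)] [folklore] -/
theorem stub_hermiteMoveRat : ∀ (A B : ℤ) (u g : ℚ[X]), 4 * A ^ 3 + 27 * B ^ 2 < 0 →
    ∀ (E : Set ℝ), E = {y : ℝ | 0 < y ^ 3 + (A : ℝ) * y + (B : ℝ)} \
      connectedComponentIn {y : ℝ | 0 < y ^ 3 + (A : ℝ) * y + (B : ℝ)} (1 + |(A : ℝ)| + |(B : ℝ)|) →
    (∀ y ∈ closure E, aeval y g ≠ 0) →
    ∀ r : KZ.IntegralRep 1, r.domain = {x | x 0 ∈ E} →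
      EqOn r.integrand (fun x =>
        (2 * (x 0 ^ 3 + (A : ℝ) * x 0 + (B : ℝ)) *
            (aeval (x 0) (derivative u) * aeval (x 0) g - aeval (x 0) u * aeval (x 0) (derivative g)) +
          (3 * x 0 ^ 2 + (A : ℝ)) * aeval (x 0) u * aeval (x 0) g) /
        (2 * (aeval (x 0) g) ^ 2 * Real.sqrt (x 0 ^ 3 + (A : ℝ) * x 0 + (B : ℝ)))) r.domain →
      KZ.of r ∈ KZ.relations := by
  intro A B u g hΔ E hE hg r hr hri
  obtain ⟨e₃, e₂, h32, he₃, he₂, hpos, hIoo⟩ := hermiteMoveRat_roots A B hΔ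
  rw [← hE] at hIoo
  subst hIoo
  rw [closure_Ioo h32.ne] at hg
  -- the endpoints are real algebraic: roots of the non-zero `P ∈ ℚ[X]`
  have hP0 : (X ^ 3 + C (A : ℚ) * X + C (B : ℚ) : ℚ[X]) ≠ 0 := by
    intro h
    have h1 := hpos ((e₃ + e₂) / 2) ⟨by linarith, by linarith⟩
    have h2 := hermiteMoveRat_aeval_cubic A B ((e₃ + e₂) / 2)
    rw [h, map_zero] at h2
    linarith
  have h3a : IsAlgebraic ℚ e₃ := ⟨_, hP0, by rw [hermiteMoveRat_aeval_cubic, he₃]⟩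
  have h2a : IsAlgebraic ℚ e₂ := ⟨_, hP0, by rw [hermiteMoveRat_aeval_cubic, he₂]⟩
  have hsnoc : ∀ (x : Fin 0 → ℝ) (t : ℝ), (Fin.snoc x t : Fin 1 → ℝ) 0 = t := fun _ _ => rfl
  -- the two endpoints `D = {e₃, e₂} ⊆ ℝ¹`: semialgebraic, null, disjoint from `r.domain`
  obtain ⟨D, hDdef⟩ : ∃ D : Set (Fin 1 → ℝ), D = {z | z 0 = e₃ ∨ z 0 = e₂} := ⟨_, rfl⟩
  have hD : IsSemialgebraic ℚ D := by
    rw [hDdef]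
    exact (isSemialgebraic_setOf_apply_eq_of_isAlgebraic h3a 0).union
      (isSemialgebraic_setOf_apply_eq_of_isAlgebraic h2a 0)
  have hDvol : volume D = 0 := by
    have : D = {fun _ => e₃, fun _ => e₂} := by
      rw [hDdef]; ext z; simp [funext_iff, Fin.forall_fin_one]
    rw [this]
    exact (Set.toFinite _).measure_zero _
  have hDr : ∀ z ∈ D, z ∉ r.domain := by
    intro z hz hzr
    rw [hDdef] at hz
    rw [hr, mem_setOf_eq, mem_Ioo] at hzr
    rcases hz with h | h <;> rw [h] at hzr <;> linarith [hzr.1, hzr.2]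
  -- the closed band `[e₃, e₂] = r.domain ∪ D` with the integrand `𝟙_{r.domain} r.integrand`
  have hB : IsSemialgebraic ℚ (r.domain ∪ D) := r.isSemialgebraic_domain.union hD
  have hBmem : ∀ z ∈ r.domain ∪ D, z 0 ∈ Icc e₃ e₂ := by
    intro z hz
    rw [hDdef, hr] at hz
    rcases hz with hz | hz | hz
    · exact Ioo_subset_Icc_self hz
    · rw [mem_Icc, hz]; exact ⟨le_rfl, h32.le⟩
    · rw [mem_Icc, hz]; exact ⟨h32.le, le_rfl⟩
  have hBfun : IsSemialgebraicFunOn ℚ (r.domain ∪ D) (indicator r.domain r.integrand) :=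
    IsSemialgebraicFunOn.union r.isSemialgebraicFunOn_integrand
      ((isSemialgebraicFunOn_aeval hD (0 : MvPolynomial (Fin 1) ℚ)).congr fun z hz => by
        simp [indicator_of_notMem (hDr z hz)])
      (fun z hz => indicator_of_mem hz _) (fun _ _ => rfl)
  have hBint : IntegrableOn (indicator r.domain r.integrand) (r.domain ∪ D) :=
    ((integrable_indicator_iff (KZ.IntegralRep.measurableSet_domain_holds r)).mpr
      r.integrableOn).integrableOn
  obtain ⟨rb, hrbd, hrbi⟩ : ∃ rb : KZ.IntegralRep 1, rb.domain = r.domain ∪ D ∧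
      rb.integrand = indicator r.domain r.integrand :=
    ⟨⟨r.domain ∪ D, indicator r.domain r.integrand, hB, hBfun, hBint⟩, rfl, rfl⟩
  -- the base `[ℝ⁰, 0]`
  obtain ⟨r₀, hr₀d, hr₀i⟩ := KZ.exists_zeroRep (n := 0) (σ := univ) isSemialgebraic_univ
  -- the primitive `F = (u/g)√P` is semialgebraic on the band
  have hF : IsSemialgebraicFunOn ℚ (r.domain ∪ D)
      (fun z => aeval (z 0) u / aeval (z 0) g * Real.sqrt (z 0 ^ 3 + (A : ℝ) * z 0 + (B : ℝ))) :=
    IsSemialgebraicFunOn.mul_holds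
      (hermiteMoveRat_isSemialgebraicFunOn_div hB u g 0 fun z hz => hg _ (hBmem z hz))
      (IsSemialgebraicFunOn.sqrt_holds
        ((RealEllipticSectorKernel.exactForm_isSemialgebraicFunOn_aeval_apply hB
          (X ^ 3 + C (A : ℚ) * X + C (B : ℚ)) 0).congr
            fun z _ => hermiteMoveRat_aeval_cubic A B (z 0)))
  -- ONE Newton–Leibniz move
  have hNL : KZ.of rb - KZ.of r₀ ∈ KZ.newtonLeibnizRel := by
    refine ⟨0, rb, r₀, fun _ => e₃, fun _ => e₂,
      fun z => aeval (z 0) u / aeval (z 0) g * Real.sqrt (z 0 ^ 3 + (A : ℝ) * z 0 + (B : ℝ)),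
      hrbd ▸ hF, ?_, ?_, fun _ _ => h32.le, ?_, ?_, ?_, ?_, rfl⟩
    · rw [hr₀d]; exact isSemialgebraicFunOn_const_of_isAlgebraic isSemialgebraic_univ h3a
    · rw [hr₀d]; exact isSemialgebraicFunOn_const_of_isAlgebraic isSemialgebraic_univ h2a
    · rw [hrbd, hr₀d, hDdef, hr]
      ext z
      simp only [mem_union, mem_setOf_eq, mem_Ioo, mem_univ, true_and, Fin.last_zero]
      constructor
      · rintro (⟨h1, h2⟩ | h | h)
        · exact ⟨h1.le, h2.le⟩
        · rw [h]; exact ⟨le_rfl, h32.le⟩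
        · rw [h]; exact ⟨h32.le, le_rfl⟩
      · rintro ⟨h1, h2⟩
        rcases h1.lt_or_eq with h1 | h1
        · rcases h2.lt_or_eq with h2 | h2
          · exact Or.inl ⟨h1, h2⟩
          · exact Or.inr (Or.inr h2)
        · exact Or.inr (Or.inl h1.symm)
    · intro x _
      show ContinuousOn (fun t : ℝ => aeval ((Fin.snoc x t : Fin 1 → ℝ) 0) u /
        aeval ((Fin.snoc x t : Fin 1 → ℝ) 0) g *
        Real.sqrt (((Fin.snoc x t : Fin 1 → ℝ) 0) ^ 3 + (A : ℝ) * (Fin.snoc x t : Fin 1 → ℝ) 0 +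
          (B : ℝ))) _
      simp only [hsnoc]
      exact ((Polynomial.continuous_aeval u).continuousOn.div
        (Polynomial.continuous_aeval g).continuousOn fun t ht => hg t ht).mul
        (Continuous.continuousOn (by fun_prop))
    · intro x _ t ht
      have hmem : (Fin.snoc x t : Fin 1 → ℝ) ∈ r.domain := by
        rw [hr]; exact ht
      show HasDerivAt (fun s : ℝ => aeval ((Fin.snoc x s : Fin 1 → ℝ) 0) u /
        aeval ((Fin.snoc x s : Fin 1 → ℝ) 0) g *
        Real.sqrt (((Fin.snoc x s : Fin 1 → ℝ) 0) ^ 3 + (A : ℝ) * (Fin.snoc x s : Fin 1 → ℝ) 0 +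
          (B : ℝ))) (rb.integrand (Fin.snoc x t)) t
      rw [hrbi, indicator_of_mem hmem, hri hmem]
      simp only [hsnoc]
      exact hermiteMoveRat_hasDerivAt (A : ℝ) (B : ℝ) u g (hpos t ht)
        (hg t (Ioo_subset_Icc_self ht))
    · intro x _
      simp only [hr₀i, Pi.zero_apply, hsnoc, he₃, he₂, Real.sqrt_zero, mul_zero, sub_zero]
  -- the band representation is a relation
  have hrb : KZ.of rb ∈ KZ.relations := by
    have h1 := KZ.newtonLeibnizRel_subset_relations hNL
    have h2 : KZ.of r₀ ∈ KZ.relations :=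
      KZ.of_mem_relations_of_eqOn_zero r₀ (by rw [hr₀i]; exact fun _ _ => rfl)
    simpa using KZ.relations.add_mem h1 h2
  -- ONE domain-additivity move: band versus egg, the two endpoints being null
  have hsub : D ⊆ rb.domain := by rw [hrbd]; exact subset_union_right
  have hre : KZ.of (rb.restrict D hD hsub) ∈ KZ.relations :=
    KZ.of_mem_relations_of_volume_eq_zero _ hDvol
  have hDA : KZ.of rb - KZ.of r - KZ.of (rb.restrict D hD hsub) ∈ KZ.domainAddRel :=
    ⟨1, rb, r, rb.restrict D hD hsub, by rw [KZ.IntegralRep.domain_restrict, hrbd],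
      measure_mono_null inter_subset_right hDvol,
      fun z hz => by rw [hrbi]; exact indicator_of_mem hz _, fun _ _ => rfl, rfl⟩
  have h2 : KZ.of r = KZ.of rb - (KZ.of rb - KZ.of r - KZ.of (rb.restrict D hD hsub)) -
      KZ.of (rb.restrict D hD hsub) := by abel
  rw [h2]
  exact KZ.relations.sub_mem (KZ.relations.sub_mem hrb (KZ.domainAddRel_subset_relations hDA)) hre

end Summit.KontsevichZagierPeriods.IsogenyCertificates.XMapKernelStubs.HermiteMoveRat

end
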